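import Summits.ABC.IUTFork.Joshi.MultiplicativeStructuresJoshiThm351Flag
import Summits.ABC.IUTFork.Joshi.ArithHolStructureTiltComplete
import Summits.ABC.IUTFork.Joshi.ArithHolStructureTiltAlgClosed
import Summits.ABC.IUTFork.Joshi.ArithHolStructureTiltResidueField
import Summits.ABC.IUTFork.Joshi.ArithmeticoidsClosureFibresModel
import Mathlib.NumberTheory.Basic
import HarnessLib

/-!
# [J-2½] §3 at GENUINE (un)tilts: Lem. 3.1.4 «K̃ ≃ K♭» DISCHARGED for every typed untilt (ℂ_p included); the literal group-level
# reading of Thm. 3.5.1 REFUTED hypothesis-free at print's own `F = ℂ_p♭` — companion of `MultiplicativeStructuresJoshi.lean` (p432965)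

Block E of the abc-iut cell (rung LADDER-ABC:A2.E; seat abc-iut-E-t38, [J-2½] lineage, gen 6). SOURCE: K. Joshi, *Construction of Arithmetic
Teichmüller Spaces II½*, arXiv:2305.10398**v12** (UNREFEREED; bib `Joshi2023ATS2half`; «p. N l. a–b» = PDF page/line of the cell render).
NO SIDE TAKEN on [IUTchIII] Cor. 3.12, on Joshi's claims or on Mochizuki's reports; TYPED ≠ PROVED ≠ ENDORSED. Everything here is [folklore]
mathematics ([Scholze 2012] = *Perfectoid spaces*, Publ. IHÉS 116, Lem. 3.4) on OUR carriers; no claim-`Prop` of the preprint is asserted.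
PROOF-ONLY: no `def`, no instance, no notation, no `Prop` hypothesis; standard axioms; sorry-free.

OPEN IN THE PARENTS. (a) p432965 typed **Lem. 3.1.4** (p. 17 l. 3–9 «There is a continuous isomorphism of multiplicative monoids K̃ ≃ K♭ …
[Scholze, 2012, Lemma 3.4]») as the claim-`Prop` `Lem314 K p K♭ := Nonempty (K̃ ≃ₜ* K♭)` over ABSTRACT `K`, `K♭` — a HYPOTHESIS («Mathlib has
the RING-level tilt, not this monoid comparison»). (b) p432965 typed **Thm. 3.5.1** (p. 19 l. 27–40 «isomorphism of the ℤ_p-modules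
(𝔪_F, +) →^{AH} (1 + 𝔪_F, ×)») at GROUP level with the ORDINARY addition (`Thm351`); E-t13's p434597 `not_thm351_of_charP` refuted that
reading in characteristic `p` UNDER BINDERS («𝔽_p((t)), ℂ_p♭ … not constructed here»); three concordant readers (E-t60 / E-t13 / E-t15,
2026-08-26 09:22–09:36Z) located print's «(𝔪_F, +)» as the Lubin–Tate / Artin–Hasse-transported law ([FF18] Ex. 4.4.7, E-lit EL-138; faithful
slot = E-t13's `Thm351Linear`, p433396); E-t15 asked for the NV «a constructed char-p valued field», E-t60 for the binder discharge.

PROVED HERE, on E-t10's kernel tilt of an arbitrary typed untilt `U : Joshi.Untilt p` (E-t1) — Mathlib's `Tilt K ‖·‖ 𝒪_K p =: ATS1.tilt U`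
with the norm `normedFieldTilt U` (CharP / IsAlgClosed / CompleteSpace / IsUltrametricDist / value group of `K`: p442777…p447287) and
the Teichmüller tower map `flatFr : K♭ →* (ℕ → K)` onto `lim_{x ↦ x^p} K` (= p432965's `tildeMonoid K p`, carrier-for-carrier):
1. §1–§2 (`Untilts.*`): `|f − g|_♭ ≤ ‖p‖^{pᵏ} ⟺ (f^{1/pᵏ})^♯ ≡ (g^{1/pᵏ})^♯ (mod p)` on `𝒪_{K♭} = (𝒪_K/p)^perf`, sharpened to `(mod p^{m+1})`
   from degree `k + m` (Mathlib `dvd_sub_pow_of_dvd_sub`); `flatFr` is injective, continuous and open onto the tower monoid: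
   **`K♭ ≃ₜ* lim_{x ↦ x^p} K`** as TOPOLOGICAL multiplicative monoids (`nonempty_continuousMulEquiv`; product topology on the towers).
2. §3 **`lem314_untilt`** / **`lem314_padicComplex`**: `Lem314 U.K p (ATS1.tilt U)` HOLDS for EVERY typed untilt, e.g. `K = ℂ_p` (E-t1's
   `Untilt.padicComplex` = Mathlib's `PadicComplex`) — registry J2h:Lem3.1.4: HYPOTHESIS → the cited theorem's reading DISCHARGED in kernel.
3. §4 **`not_thm351_of_charP'`** (E-t13's refutation, binder discharged, no topology: hypotheses = `[CharP F p]` + the valued-field data),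
   **`not_thm351_tilt`**, **`not_thm351_padicComplexTilt`** (`¬ Thm351` at `F = ℂ_p♭`, print's own «e.g. F = ℂ♭_p», p. 19 l. 28),
   **`exists_perfectoid_not_thm351`** (the hypothesis-free kernel sentence: an algebraically closed complete ultrametric field of
   characteristic `p` at whose norm the literal reading fails). Refuted-AS-TYPED ≠ refuted-in-print: the located reading (`Thm351Linear`)
   is untouched. POINTER: the analytic core of the cited [FF18] Ex. 4.4.7 — the Artin–Hasse series with Dwork's integrality lemma — IS in
   the tree (`Literature/NumberTheory/LFunctions/DworkRationalitySplitting.lean` `artinHasse`, `…DworkLemma.lean`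
   `norm_coeff_artinHasse_le_one`), so a formal-group discharge of that reading is typable later. bears_on: LADDER-ABC:A2.E.
-/

noncomputable section

open scoped NNReal
open Filter Topology

namespace Summit.ABC.IUTFork.Joshi.ATS2half

open Summit.ABC.IUTFork.Joshi
open Summit.ABC.IUTFork.Joshi.ATS1
open Summit.ABC.IUTFork.Joshi.ATS1.TiltModel
open Summit.ABC.IUTFork.Joshi.ATS2h (IsValuedField)

universe u
variable {p : ℕ} [Fact p.Prime]

namespace Untilts

/-! ## 1. `𝒪_{K♭} = (𝒪_K/p)^perf`: `|·|_♭`-closeness versus `p`-adic closeness of the Teichmüller towers -/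

section Integral

variable (U : Untilt p) [Fact (¬ IsUnit ((p : ℕ) : int U))] [IsAdicComplete (Ideal.span {((p : ℕ) : int U)}) (int U)]

/-- The `k`-th coordinate of E-t10's `flatInt f = ((f^{1/pᵏ})^♯)_k` as an element of `𝒪_K`: the `k`-th coefficient of the Teichmüller
lift `(quotientMulEquiv p (p))⁻¹ f ∈ lim_{x ↦ x^p} 𝒪_K`. [folklore] -/
theorem flatInt_apply (f : PreTilt (int U) p) (k : ℕ) :
    flatInt U f k = ((Perfection.coeffMonoidHom (int U) p k
      ((Perfection.quotientMulEquiv p (Ideal.span {((p : ℕ) : int U)})).symm f) : int U) : U.K) := rfl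

/-- The `k`-th coefficient of `f ∈ (𝒪_K/p)^perf` IS the reduction mod `p` of the `k`-th Teichmüller coordinate (Mathlib
`Perfection.coeff_quotientMulEquiv`). [folklore] -/
theorem coeff_eq_mk_coord (f : PreTilt (int U) p) (k : ℕ) :
    PreTilt.coeff k f = Ideal.Quotient.mk (Ideal.span {((p : ℕ) : int U)})
      (Perfection.coeffMonoidHom (int U) p k ((Perfection.quotientMulEquiv p (Ideal.span {((p : ℕ) : int U)})).symm f)) := by
  have h := Perfection.coeff_quotientMulEquiv (I := Ideal.span {((p : ℕ) : int U)})
    ((Perfection.quotientMulEquiv p (Ideal.span {((p : ℕ) : int U)})).symm f) k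
  rw [MulEquiv.apply_symm_apply] at h; exact h

/-- **`|f − g|_♭ ≤ ‖p‖^{pᵏ} ⟺ ‖(f^{1/pᵏ})^♯ − (g^{1/pᵏ})^♯‖ ≤ ‖p‖`**: E-t10's coefficient criterion `coeff_eq_coeff_iff` read on the
Teichmüller towers (equal `k`-th coefficients ⟺ `k`-th tower coordinates congruent mod `p`). PROVED. [folklore] -/
theorem valInt_sub_le_iff (f g : PreTilt (int U) p) (k : ℕ) :
    valInt U (f - g) ≤ ‖(p : U.K)‖₊ ^ p ^ k ↔ ‖flatInt U f k - flatInt U g k‖ ≤ ‖(p : U.K)‖ := by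
  rw [← coeff_eq_coeff_iff, coeff_eq_mk_coord, coeff_eq_mk_coord, Ideal.Quotient.eq, mem_span_p_iff, flatInt_apply, flatInt_apply,
    AddSubgroupClass.coe_sub]

/-- **Uniform `p`-adic continuity of each tower coordinate**: `|f − g|_♭ ≤ ‖p‖^{p^{k+m}} ⟹ ‖(f^{1/pᵏ})^♯ − (g^{1/pᵏ})^♯‖ ≤ ‖p‖^{m+1}`
(the degree-`(k+m)` coordinates are congruent mod `p`, and `a ≡ b (p) ⟹ a^{p^m} ≡ b^{p^m} (p^{m+1})`; the `p^m`-th power of the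
degree-`(k+m)` coordinate is the degree-`k` coordinate). PROVED. [folklore] -/
theorem norm_flatInt_sub_le (f g : PreTilt (int U) p) (k m : ℕ) (h : valInt U (f - g) ≤ ‖(p : U.K)‖₊ ^ p ^ (k + m)) :
    ‖flatInt U f k - flatInt U g k‖ ≤ ‖(p : U.K)‖ ^ (m + 1) := by
  set I : Ideal (int U) := Ideal.span {((p : ℕ) : int U)} with hI
  set a : int U := Perfection.coeffMonoidHom (int U) p (k + m) ((Perfection.quotientMulEquiv p I).symm f) with ha
  set b : int U := Perfection.coeffMonoidHom (int U) p (k + m) ((Perfection.quotientMulEquiv p I).symm g) with hb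
  have hab : ((p : ℕ) : int U) ∣ a - b := by
    have hc := (coeff_eq_coeff_iff U f g (k + m)).2 h
    rw [coeff_eq_mk_coord, coeff_eq_mk_coord, Ideal.Quotient.eq, Ideal.mem_span_singleton] at hc
    exact hc
  have hpow := dvd_sub_pow_of_dvd_sub hab m
  rw [ha, hb, Perfection.coeffMonoidHom_pow_p_pow', Perfection.coeffMonoidHom_pow_p_pow'] at hpow
  obtain ⟨c, hc⟩ := hpow
  have hcoe : flatInt U f k - flatInt U g k = (((p : ℕ) : int U) ^ (m + 1) * c : int U) := by
    rw [← hc, AddSubgroupClass.coe_sub, flatInt_apply, flatInt_apply]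
  rw [hcoe, Subring.coe_mul, Subring.coe_pow, Subring.coe_natCast, norm_mul, norm_pow]
  exact mul_le_of_le_one_right (pow_nonneg (norm_nonneg _) _) (norm_coe_le_one c)

end Integral

/-! ## 2. `K♭ = Frac 𝒪_{K♭}`: the tower map is injective, continuous, and open onto `lim_{x ↦ x^p} K` -/

section Frac

variable (U : Untilt p) [Fact (¬ IsUnit ((p : ℕ) : int U))] [IsDomain (PreTilt (int U) p)]
  [IsAdicComplete (Ideal.span {((p : ℕ) : int U)}) (int U)]

/-- `flatFr` extends `flatInt` along `𝒪_{K♭} → K♭`. [folklore] -/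
theorem flatFr_algebraMap (a : PreTilt (int U) p) : flatFr U (algebraMap _ (tiltFr U) a) = flatInt U a := by
  rw [← IsLocalization.mk'_one (M := nonZeroDivisors (PreTilt (int U) p)) (tiltFr U) a, flatFr_mk', OneMemClass.coe_one, map_one,
    inv_one, mul_one]

/-- **`x ↦ (x^{♯ 1/pⁿ})_n` is INJECTIVE on `K♭`** (clear denominators coordinatewise — no coordinate of the tower of a non-zero-divisor
vanishes — and use E-t10's `flatInt_injective` on `𝒪_{K♭}`). PROVED. [folklore] -/
theorem flatFr_injective : Function.Injective (flatFr U) := by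
  intro z w h
  obtain ⟨⟨a, s⟩, rfl⟩ := IsLocalization.mk'_surjective (nonZeroDivisors (PreTilt (int U) p)) z
  obtain ⟨⟨b, t⟩, rfl⟩ := IsLocalization.mk'_surjective (nonZeroDivisors (PreTilt (int U) p)) w
  rw [flatFr_mk', flatFr_mk'] at h
  have key : flatInt U (a * t) = flatInt U (b * s) := by
    rw [map_mul, map_mul]
    funext n
    have hn := congr_fun h n
    simp only [Pi.mul_apply, Pi.inv_apply, ← div_eq_mul_inv] at hn
    exact (div_eq_div_iff (flatInt_apply_ne_zero U (nonZeroDivisors.coe_ne_zero s) n)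
      (flatInt_apply_ne_zero U (nonZeroDivisors.coe_ne_zero t) n)).1 hn
  have hat : a * (t : PreTilt (int U) p) = b * s := flatInt_injective U key
  exact IsLocalization.mk'_eq_of_eq' (by simpa only [mul_comm] using hat.symm)

/-- The tower of `0` is `0`, coordinatewise (`‖(x)_0‖ = |x|_♭` and `x_n^{pⁿ} = x_0`). [folklore] -/
theorem flatFr_zero_apply (n : ℕ) : flatFr U 0 n = 0 := by
  have h0 : flatFr U 0 0 = 0 := by rw [← nnnorm_eq_zero, nnnorm_flatFr_zero, map_zero]
  have h := pow_pow_eq_head (flatFr_mem U 0) n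
  rw [h0] at h
  exact pow_eq_zero_iff (pow_ne_zero n (Fact.out : p.Prime).ne_zero) |>.1 h

/-- No coordinate of the tower of a nonzero element vanishes. [folklore] -/
theorem flatFr_apply_ne_zero {z : tiltFr U} (hz : z ≠ 0) (n : ℕ) : flatFr U z n ≠ 0 := fun h => by
  have h0 := head_eq_zero_of_apply_eq_zero (flatFr_mem U z) h
  have : valFr U z = 0 := by rw [← nnnorm_flatFr_zero, h0, nnnorm_zero]
  exact hz ((Valuation.zero_iff _).1 this)

/-- An element of `|·|_♭ ≤ 1` together with its distance to `1`: if `‖u − 1‖_♭ ≤ r ≤ 1` then `u = a/1` with `a ∈ 𝒪_{K♭}` and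
`|a − 1|_♭ ≤ r` (E-t10's `integers_valFr`: `𝒪_{K♭}` is the valuation ring). [folklore] -/
theorem exists_integral_of_norm_sub_one_le (u : tiltFr U) (r : ℝ≥0) (hr : r ≤ 1)
    (hu : letI := normedFieldFr U; ‖u - 1‖ ≤ r) :
    ∃ a : PreTilt (int U) p, algebraMap _ (tiltFr U) a = u ∧ valInt U (a - 1) ≤ r := by
  letI := normedFieldFr U
  haveI := isUltrametricDist_Fr U
  have hu1 : ‖u‖ ≤ 1 := by
    rw [show u = (u - 1) + 1 by ring]
    exact (IsUltrametricDist.norm_add_le_max _ _).trans (max_le (hu.trans (by exact_mod_cast hr)) (by rw [norm_one]))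
  have hv1 : valFr U u ≤ 1 := by rw [norm_eq_valFr U u] at hu1; exact_mod_cast hu1
  obtain ⟨a, ha⟩ := (integers_valFr U).exists_of_le_one hv1
  refine ⟨a, ha, ?_⟩
  have h2 : valFr U (u - 1) ≤ r := by rw [norm_eq_valFr U (u - 1)] at hu; exact_mod_cast hu
  rwa [← ha, ← map_one (algebraMap (PreTilt (int U) p) (tiltFr U)), ← map_sub, valFr_algebraMap] at h2

/-- **Each tower coordinate `z ↦ (z^{1/pᵏ})^♯` is CONTINUOUS `K♭ → K`** for `‖·‖_♭` (at `0`: `‖(z)_k‖^{pᵏ} = ‖z‖_♭`; at `z₀ ≠ 0`: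
`z = u·z₀` with `‖u − 1‖_♭ ≤ ‖p‖^{p^{k+m}}`, `u ∈ 𝒪_{K♭}`, and §1 gives `‖(u)_k − 1‖ ≤ ‖p‖^{m+1}`). PROVED. [folklore] -/
theorem continuous_flatFr_apply (k : ℕ) : letI := normedFieldFr U; Continuous fun z => flatFr U z k := by
  letI := normedFieldFr U
  have hp0 : 0 < ‖(p : U.K)‖ := norm_pos_iff.2 (natCast_p_ne_zero U)
  have hp1 : ‖(p : U.K)‖ < 1 := U.norm_p_lt_one
  rw [Metric.continuous_iff]
  intro z₀ ε hε
  by_cases hz₀ : z₀ = 0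
  · subst hz₀
    refine ⟨ε ^ p ^ k, pow_pos hε _, fun z hz => ?_⟩
    rw [dist_eq_norm, flatFr_zero_apply, sub_zero]
    rw [dist_eq_norm, sub_zero, norm_eq_valFr, ← nnnorm_flatFr_zero, coe_nnnorm, ← norm_pow_pow_eq_head (flatFr_mem U z) k] at hz
    exact lt_of_pow_lt_pow_left₀ _ hε.le hz
  · set c := ‖flatFr U z₀ k‖ with hc
    have hc0 : 0 < c := norm_pos_iff.2 (flatFr_apply_ne_zero U hz₀ k)
    obtain ⟨m, hm⟩ := exists_pow_lt_of_lt_one (div_pos hε hc0) hp1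
    have hz₀n : 0 < ‖z₀‖ := norm_pos_iff.2 hz₀
    refine ⟨‖z₀‖ * ‖(p : U.K)‖ ^ p ^ (k + m), mul_pos hz₀n (pow_pos hp0 _), fun z hz => ?_⟩
    rw [dist_eq_norm] at hz ⊢
    set u := z / z₀ with hu
    have hzu : z = u * z₀ := by rw [hu, div_mul_cancel₀ z hz₀]
    have hu1 : ‖u - 1‖ ≤ ((‖(p : U.K)‖₊ ^ p ^ (k + m) : ℝ≥0) : ℝ) := by
      have : u - 1 = (z - z₀) / z₀ := by rw [hu, sub_div, div_self hz₀]
      rw [this, norm_div, div_le_iff₀ hz₀n, NNReal.coe_pow, coe_nnnorm, mul_comm]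
      exact hz.le
    obtain ⟨a, hau, ha1⟩ := exists_integral_of_norm_sub_one_le U u _
      (pow_le_one₀ zero_le (by exact_mod_cast hp1.le)) hu1
    have hcoord : ‖flatInt U a k - 1‖ ≤ ‖(p : U.K)‖ ^ (m + 1) := by
      have h := norm_flatInt_sub_le U a 1 k m ha1
      rwa [map_one, Pi.one_apply] at h
    have hzk : flatFr U z k = flatInt U a k * flatFr U z₀ k := by
      rw [hzu, map_mul, Pi.mul_apply, ← hau, flatFr_algebraMap]
    rw [hzk, ← sub_one_mul, norm_mul, ← hc]
    calc ‖flatInt U a k - 1‖ * c ≤ ‖(p : U.K)‖ ^ (m + 1) * c := mul_le_mul_of_nonneg_right hcoord hc0.le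
      _ ≤ ‖(p : U.K)‖ ^ m * c :=
          mul_le_mul_of_nonneg_right (pow_le_pow_of_le_one hp0.le hp1.le (Nat.le_succ m)) hc0.le
      _ < ε := by rwa [← lt_div_iff₀ hc0]

/-- **The tower map `K♭ → (ℕ → K)` is continuous** (product topology). PROVED. [folklore] -/
theorem continuous_flatFr : letI := normedFieldFr U; Continuous (flatFr U : tiltFr U → ℕ → U.K) :=
  letI := normedFieldFr U; continuous_pi fun k => continuous_flatFr_apply U k

/-- **Openness estimate (continuity of the inverse)**: if the `k`-th coordinates of the towers of `z` and `z₀ ≠ 0` are RELATIVELY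
`p`-close, `‖(z)_k − (z₀)_k‖ < ‖p‖·‖(z₀)_k‖`, then `‖z − z₀‖_♭ ≤ ‖z₀‖_♭ · ‖p‖^{pᵏ}` (`u = z/z₀ ∈ 𝒪_{K♭}` has `(u)_k ≡ 1 (p)`, so §1
gives `|u − 1|_♭ ≤ ‖p‖^{pᵏ}`). PROVED. [folklore] -/
theorem norm_sub_le_of_coord {z₀ : tiltFr U} (hz₀ : z₀ ≠ 0) (k : ℕ) (z : tiltFr U)
    (h : ‖flatFr U z k - flatFr U z₀ k‖ < ‖(p : U.K)‖ * ‖flatFr U z₀ k‖) :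
    letI := normedFieldFr U; ‖z - z₀‖ ≤ ‖z₀‖ * ‖(p : U.K)‖ ^ p ^ k := by
  letI := normedFieldFr U
  have hp1 : ‖(p : U.K)‖ < 1 := U.norm_p_lt_one
  set u := z / z₀ with hu
  have hzu : z = u * z₀ := by rw [hu, div_mul_cancel₀ z hz₀]
  have hc0 : 0 < ‖flatFr U z₀ k‖ := norm_pos_iff.2 (flatFr_apply_ne_zero U hz₀ k)
  -- the `k`-th coordinate of `u` is `p`-adically within `‖p‖` of `1`
  have huk : ‖flatFr U u k - 1‖ < ‖(p : U.K)‖ := by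
    have h' : ‖(flatFr U u k - 1) * flatFr U z₀ k‖ < ‖(p : U.K)‖ * ‖flatFr U z₀ k‖ := by
      rwa [sub_one_mul, ← Pi.mul_apply, ← map_mul, ← hzu]
    rw [norm_mul] at h'
    exact lt_of_mul_lt_mul_right h' hc0.le
  -- hence `‖(u)_k‖ ≤ 1`, `‖u‖_♭ = ‖(u)_k‖^{pᵏ} ≤ 1`, and `u` is integral
  have huk1 : ‖flatFr U u k‖ ≤ 1 := by
    rw [show flatFr U u k = (flatFr U u k - 1) + 1 by ring]
    exact (IsUltrametricDist.norm_add_le_max _ _).trans (max_le (huk.le.trans hp1.le) (by rw [norm_one]))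
  have hun : ‖u‖ ≤ 1 := by
    rw [norm_eq_valFr, ← nnnorm_flatFr_zero, coe_nnnorm, ← norm_pow_pow_eq_head (flatFr_mem U u) k]
    exact pow_le_one₀ (norm_nonneg _) huk1
  have hv1 : valFr U u ≤ 1 := by rw [norm_eq_valFr U u] at hun; exact_mod_cast hun
  obtain ⟨a, ha⟩ := (integers_valFr U).exists_of_le_one hv1
  -- §1: `(a)_k ≡ 1 (p)` gives `|a − 1|_♭ ≤ ‖p‖^{pᵏ}`
  have hak : ‖flatInt U a k - flatInt U 1 k‖ ≤ ‖(p : U.K)‖ := by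
    rw [map_one, Pi.one_apply, ← flatFr_algebraMap, ha]
    exact huk.le
  have hval : valInt U (a - 1) ≤ ‖(p : U.K)‖₊ ^ p ^ k := (valInt_sub_le_iff U a 1 k).2 hak
  have hval' : ‖u - 1‖ ≤ ‖(p : U.K)‖ ^ p ^ k := by
    rw [norm_eq_valFr, ← ha, ← map_one (algebraMap (PreTilt (int U) p) (tiltFr U)), ← map_sub, valFr_algebraMap]
    exact_mod_cast hval
  have hsub : z - z₀ = (u - 1) * z₀ := by rw [sub_one_mul, ← hzu]
  rw [hsub, norm_mul, mul_comm]
  exact mul_le_mul_of_nonneg_left hval' (norm_nonneg _)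

/-- **`K♭ ≃ₜ* lim_{x ↦ x^p} K`**: the tower map is a multiplicative HOMEOMORPHISM of `(K♭, ‖·‖_♭)` onto the `p`-power-compatible
sequences with the product topology ([Scholze 2012, Lem. 3.4 (i)/(iii)] «`𝒪_{K♭} ≅ lim 𝒪_K`, `K♭ ≅ lim K`» as TOPOLOGICAL multiplicative
monoids). Built inside the proof from E-t10's `flatFr` (onto: `flatFr_surj`), `flatFr_injective`, `continuous_flatFr` and
`norm_sub_le_of_coord`. PROVED. [folklore] -/
theorem nonempty_continuousMulEquiv : letI := normedFieldFr U; Nonempty (tiltFr U ≃ₜ* powerCompatSeq U) := by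
  letI := normedFieldFr U
  have hp0 : 0 < ‖(p : U.K)‖ := norm_pos_iff.2 (natCast_p_ne_zero U)
  have hp1 : ‖(p : U.K)‖ < 1 := U.norm_p_lt_one
  let e : tiltFr U ≃* powerCompatSeq U :=
    MulEquiv.ofBijective ((flatFr U).codRestrict (powerCompatSeq U) (flatFr_mem U))
      ⟨fun z w h => flatFr_injective U (congrArg Subtype.val h), fun x => by
        obtain ⟨z, hz⟩ := flatFr_surj U x.1 x.2
        exact ⟨z, Subtype.ext hz⟩⟩
  have he : ∀ z, ((e z : powerCompatSeq U) : ℕ → U.K) = flatFr U z := fun z => rfl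
  have hcont : Continuous e := (continuous_flatFr U).subtype_mk fun z => flatFr_mem U z
  have hinv : Continuous e.symm := by
    rw [continuous_iff_continuousAt]
    intro x₀
    set z₀ := e.symm x₀ with hz₀
    have hx₀ : (x₀ : ℕ → U.K) = flatFr U z₀ := by rw [← he, hz₀, MulEquiv.apply_symm_apply]
    rw [ContinuousAt, Metric.tendsto_nhds]
    intro ε hε
    by_cases h0 : z₀ = 0
    · have hopen : IsOpen {x : powerCompatSeq U | ‖(x : ℕ → U.K) 0‖ < ε} :=
        isOpen_lt (continuous_norm.comp ((continuous_apply 0).comp continuous_subtype_val)) continuous_const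
      have hmem : x₀ ∈ {x : powerCompatSeq U | ‖(x : ℕ → U.K) 0‖ < ε} := by
        show ‖(x₀ : ℕ → U.K) 0‖ < ε
        rw [hx₀, h0, flatFr_zero_apply, norm_zero]; exact hε
      filter_upwards [hopen.mem_nhds hmem] with x hx
      have hxz : (x : ℕ → U.K) = flatFr U (e.symm x) := by rw [← he, MulEquiv.apply_symm_apply]
      rw [dist_eq_norm, ← hz₀, h0, sub_zero, norm_eq_valFr, ← nnnorm_flatFr_zero, coe_nnnorm, ← hxz]
      exact hx
    · obtain ⟨k, hk⟩ := exists_pow_lt_of_lt_one (div_pos hε (norm_pos_iff.2 h0)) hp1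
      have hck : 0 < ‖(p : U.K)‖ * ‖flatFr U z₀ k‖ := mul_pos hp0 (norm_pos_iff.2 (flatFr_apply_ne_zero U h0 k))
      have hopen : IsOpen {x : powerCompatSeq U | ‖(x : ℕ → U.K) k - flatFr U z₀ k‖ < ‖(p : U.K)‖ * ‖flatFr U z₀ k‖} :=
        isOpen_lt (continuous_norm.comp (((continuous_apply k).comp continuous_subtype_val).sub continuous_const))
          continuous_const
      have hmem : x₀ ∈ {x : powerCompatSeq U | ‖(x : ℕ → U.K) k - flatFr U z₀ k‖ < ‖(p : U.K)‖ * ‖flatFr U z₀ k‖} := by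
        show ‖(x₀ : ℕ → U.K) k - flatFr U z₀ k‖ < ‖(p : U.K)‖ * ‖flatFr U z₀ k‖
        rw [hx₀, sub_self, norm_zero]; exact hck
      filter_upwards [hopen.mem_nhds hmem] with x hx
      have hxz : (x : ℕ → U.K) = flatFr U (e.symm x) := by rw [← he, MulEquiv.apply_symm_apply]
      have hx' : ‖flatFr U (e.symm x) k - flatFr U z₀ k‖ < ‖(p : U.K)‖ * ‖flatFr U z₀ k‖ := by rw [← hxz]; exact hx
      have hle := norm_sub_le_of_coord U h0 k (e.symm x) hx'
      rw [dist_eq_norm, ← hz₀]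
      calc ‖e.symm x - z₀‖ ≤ ‖z₀‖ * ‖(p : U.K)‖ ^ p ^ k := hle
        _ ≤ ‖z₀‖ * ‖(p : U.K)‖ ^ k := mul_le_mul_of_nonneg_left
            (pow_le_pow_of_le_one hp0.le hp1.le (Nat.lt_pow_self (Fact.out : p.Prime).one_lt).le) (norm_nonneg _)
        _ < ε := by rwa [← lt_div_iff₀' (norm_pos_iff.2 h0)]
  exact ⟨{ e with continuous_toFun := hcont, continuous_invFun := hinv }⟩

/-- The same homeomorphism from the tower side: `lim_{x ↦ x^p} K ≃ₜ* K♭` (the orientation of p432965's `Lem314`). PROVED. [folklore] -/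
theorem nonempty_continuousMulEquiv_symm : letI := normedFieldFr U; Nonempty (powerCompatSeq U ≃ₜ* tiltFr U) := by
  letI := normedFieldFr U
  obtain ⟨e⟩ := nonempty_continuousMulEquiv U
  exact ⟨e.symm⟩

end Frac

end Untilts

/-! ## 3. Lem. 3.1.4 DISCHARGED at every typed untilt -/

/-- **[J-2½] Lem. 3.1.4 at a GENUINE untilt** (p. 17 l. 3–9: «There is a continuous isomorphism of multiplicative monoids K̃ ≃ K♭ …
[Scholze, 2012, Lemma 3.4]»): for EVERY typed untilt `U` (E-t1's `Joshi.Untilt p`: a complete, algebraically closed, ultrametric normed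
field `K ⊇ ℚ_p` with `‖p‖ < 1`), p432965's claim-`Prop` `Lem314 K p K♭` HOLDS with `K♭ :=` Mathlib's tilt `ATS1.tilt U` carrying E-t10's
norm `normedFieldTilt U`: `K̃ = lim_{x ↦ x^p} K ≃ₜ* K♭`. Our kernel check of the typed sentence on our carriers — the cited theorem's
reading, not an endorsement of the preprint. PROVED. [folklore] -/
theorem lem314_untilt (U : Untilt p) : letI := normedFieldTilt U; Lem314 U.K p (tilt U) := by
  haveI : Fact (¬ IsUnit ((p : ℕ) : int U)) := ⟨not_isUnit_p U⟩
  haveI : IsDomain (PreTilt (int U) p) := isDomain_preTilt U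
  haveI : IsAdicComplete (Ideal.span {((p : ℕ) : int U)}) (int U) := isAdicComplete_int U
  exact Untilts.nonempty_continuousMulEquiv_symm U

/-- **Lem. 3.1.4 for `K = ℂ_p`, `K♭ = ℂ_p♭`** (E-t1's `Untilt.padicComplex` = Mathlib's `PadicComplex`): `lim_{x ↦ x^p} ℂ_p ≃ₜ* ℂ_p♭`.
PROVED. [folklore] -/
theorem lem314_padicComplex (p : ℕ) [Fact p.Prime] :
    letI := normedFieldTilt (Untilt.padicComplex p); Lem314 ℂ_[p] p (tilt (Untilt.padicComplex p)) :=
  lem314_untilt (Untilt.padicComplex p)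

/-! ## 4. Thm. 3.5.1, literal group-level reading: refuted hypothesis-free, at print's own `F = ℂ_p♭` -/

/-- The norm of an ultrametric normed field is non-archimedean in §2.3's sense (`A = 1`). [folklore] -/
theorem isNonarchimedeanAbs_norm (F : Type u) [NormedField F] [IsUltrametricDist F] :
    IsNonarchimedeanAbs (fun x : F => ‖x‖) :=
  fun x y => IsUltrametricDist.norm_add_le_max x y

/-- **E-t13's `not_thm351_of_charP` with its last binder discharged** (E-t60's located addendum, 2026-08-26 09:32Z): a Bourbaki valued
field is non-trivially valued, so some `x ≠ 0` has `|x| < 1` (take the non-trivial witness or its inverse); and no topology is needed.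
Hypotheses: `[CharP F p]` and the valued-field data, nothing else. So in characteristic `p` the literal group-level reading
`Thm351` («`∃ e : 𝔪_F ≃ 1 + 𝔪_F`, `e (a + b) = e a · e b`» with the ORDINARY addition) fails for EVERY non-archimedean valued field.
PROVED. [folklore] -/
theorem not_thm351_of_charP' {F : Type u} [Field F] {absF : F → ℝ} (p : ℕ) [Fact p.Prime] [CharP F p]
    (hv : IsValuedField absF) (hna : IsNonarchimedeanAbs absF) : ¬ Thm351 F absF hv hna :=
  @not_thm351_of_charP F _ absF p _ _ ⊥ hv hna (by
    obtain ⟨x, hx0, hx1⟩ := hv.nontrivial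
    rcases lt_or_gt_of_ne hx1 with h | h
    · exact ⟨x, hx0, h⟩
    · exact ⟨x⁻¹, inv_ne_zero hx0, by rw [hv.map_inv]; exact inv_lt_one_of_one_lt₀ h⟩)

/-- The norm `‖·‖_♭` of a genuine tilt is a (non-trivial) Bourbaki valued-field structure: `‖ϖ♭‖_♭ = ‖p‖_K ∈ (0, 1)` by E-t10's
`range_norm_tilt_eq` (same value group as `K`). [folklore] -/
theorem isValuedField_norm_tilt (U : Untilt p) : letI := normedFieldTilt U; IsValuedField (fun x : tilt U => ‖x‖) := by
  letI := normedFieldTilt U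
  have hmem : ‖(p : U.K)‖ ∈ Set.range (fun y : tilt U => ‖y‖) := by rw [range_norm_tilt_eq]; exact ⟨(p : U.K), rfl⟩
  obtain ⟨y, hy⟩ := hmem
  have h : ‖y‖ = ‖(p : U.K)‖ := hy
  refine IsValuedField.of_norm ⟨y, fun hy0 => ?_, by rw [h]; exact U.norm_p_lt_one.ne⟩
  rw [hy0, norm_zero] at h
  exact (norm_pos_iff.2 (natCast_p_ne_zero U)).ne h

/-- `‖·‖_♭` is non-archimedean (E-t10's `isUltrametricDist_tilt`). [folklore] -/
theorem isNonarchimedeanAbs_norm_tilt (U : Untilt p) :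
    letI := normedFieldTilt U; IsNonarchimedeanAbs (fun x : tilt U => ‖x‖) := by
  letI := normedFieldTilt U
  haveI := isUltrametricDist_tilt U
  exact isNonarchimedeanAbs_norm (tilt U)

/-- **`¬ Thm351` at the norm of EVERY genuine tilt `K♭`** (characteristic `p`: E-t10's `charP_tilt`). PROVED. [folklore] -/
theorem not_thm351_tilt (U : Untilt p) :
    letI := normedFieldTilt U
    ¬ Thm351 (tilt U) (fun x => ‖x‖) (isValuedField_norm_tilt U) (isNonarchimedeanAbs_norm_tilt U) := by
  letI := normedFieldTilt U
  haveI : CharP (tilt U) p := charP_tilt U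
  exact not_thm351_of_charP' p _ _

/-- **`¬ Thm351` AT PRINT'S OWN EXAMPLE `F = ℂ_p♭`** (Thm. 3.5.1, p. 19 l. 27–28: «Let F be an algebraically closed perfectoid field of
characteristic p > 0 (e.g. F = ℂ♭_p)»): the tilt of E-t1's `Untilt.padicComplex` (Mathlib's `ℂ_p`) with E-t10's norm. The LITERAL
group-level reading fails there — hypothesis-free kernel sentence; the located reading (Lubin–Tate law, E-t13's `Thm351Linear`) is NOT
touched. PROVED. [folklore] -/
theorem not_thm351_padicComplexTilt (p : ℕ) [Fact p.Prime] :
    letI := normedFieldTilt (Untilt.padicComplex p)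
    ¬ Thm351 (tilt (Untilt.padicComplex p)) (fun x => ‖x‖) (isValuedField_norm_tilt (Untilt.padicComplex p))
      (isNonarchimedeanAbs_norm_tilt (Untilt.padicComplex p)) :=
  not_thm351_tilt (Untilt.padicComplex p)

/-- **The kernel sentence closing E-t13's flag**: there IS an algebraically closed, complete, ultrametric normed (hence perfectoid) field
of characteristic `p` — print's hypotheses on `F` verbatim — at whose norm the literal group-level reading of [J-2½] Thm. 3.5.1 fails
(witness: `ℂ_p♭`). Refuted-AS-TYPED, not refuted-in-print. PROVED. [folklore] -/
theorem exists_perfectoid_not_thm351 (p : ℕ) [Fact p.Prime] :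
    ∃ (F : Type) (_ : NormedField F), CharP F p ∧ IsAlgClosed F ∧ CompleteSpace F ∧ IsUltrametricDist F ∧
      ∃ (hv : IsValuedField (fun x : F => ‖x‖)) (hna : IsNonarchimedeanAbs (fun x : F => ‖x‖)),
        ¬ Thm351 F (fun x => ‖x‖) hv hna :=
  ⟨tilt (Untilt.padicComplex p), normedFieldTilt _, charP_tilt _, isAlgClosed_tilt _, completeSpace_tilt _,
    isUltrametricDist_tilt _, isValuedField_norm_tilt _, isNonarchimedeanAbs_norm_tilt _, not_thm351_tilt _⟩

end Summit.ABC.IUTFork.Joshi.ATS2half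

end
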